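import Mathlib
import HarnessLib

/-!
# Crux `NoZenoR` (stmt-ResolutionOfSingularities-19943), row 8⁗ — testing stable annihilation MODULO a
# stably-annihilating regular element (the Ext-half of the ARTINIAN REDUCTION of KERNEL-g18 §2)

Route `ResolutionOfSingularities/HomologicalConductor`, chain W4.4, KERNEL-g18 §2 (lead g18).
`[OURS]` — AI-formalised, weaker than expert review; NOT a statement of any manuscript under review.

KERNEL-g18 LEMMA 2.1 says: if `x ∈ R` is regular on `R` and on a finitely generated module `N` and
`x ∈ sann_R(N)` (i.e. `x · Ext¹_R(N, −) = 0`), then `sann_R(N)` is the preimage of `sann_{R/xR}(N/xN)`: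
membership of ANY `a` in the stable annihilator can be tested after reduction modulo `x`. With
`TR² ⊆ ca⁵(⅟5(1,3,2))` (THM 1′) and the regular sequence `(y₁¹⁰, y₂¹⁰, y₃¹⁰) ⊂ TR²` this puts the whole
`⅟5` bit inside ONE artinian algebra `Λ = R/(y₁¹⁰,y₂¹⁰,y₃¹⁰)R` (dim 200). The non-formal half of the proof
(`⊇`) is: `sann_R(N) = ann Ext¹_R(N, ΩN)`, `ΩN` is `x`-torsion-free, and in the long exact sequence of
`Ext_R(N, −)` along `0 → ΩN →x ΩN → ΩN/xΩN → 0` the first map `Ext¹(N,ΩN) →x Ext¹(N,ΩN)` is ZERO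
(because `x` stably annihilates `N`), so `Ext¹(N, ΩN) → Ext¹(N, ΩN/xΩN)` is INJECTIVE and `a · ξ_N = 0` can
be read off after reduction. This file is the categorical core of exactly that step, for a short exact
`S : X₁ → X₂ → X₃` in an `R`-linear abelian category whose first map is `x •` (a multiple of) some morphism:

* `comp_mk₀_eq_zero_of_smul_eq_zero` — if `S.f = x • φ` and `x` kills `Extⁿ(N, S.X₂)`, then
  postcomposition with `S.f` is the zero map `Extⁿ(N, S.X₁) → Extⁿ(N, S.X₂)`;
* `comp_mk₀_injective_of_smul_eq_zero` — hence postcomposition with `S.g` is INJECTIVE on `Extⁿ(N, S.X₂)`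
  (Mathlib's `covariant_sequence_exact₂`);
* `smul_eq_zero_iff_smul_comp_mk₀_eq_zero` — so for every `a : R` and `e ∈ Extⁿ(N, S.X₂)`:
  `a • e = 0 ↔ a • (e ≫ S.g) = 0` — annihilation is decided in `Extⁿ(N, S.X₃)`, the «reduced» object.

Model: `S.X₁ = S.X₂ = L` an `x`-torsion-free module, `S.f = x • 𝟙 L`, `S.X₃ = L/xL`, `n = 1`, `N` with
`x ∈ sann_R(N)`; with `L = ΩN` and `e = ξ_N` this is LEMMA 2.1 (⊇). Nothing here is specific to `⅟5(1,3,2)`.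
-/

noncomputable section

-- single-problem summit: the doubled namespace component is forced
set_option linter.dupNamespace false

open CategoryTheory CategoryTheory.Abelian CategoryTheory.Limits

universe w t v u

namespace Summit.ResolutionOfSingularities.ResolutionOfSingularities.Theorems.NoZeno.ReductionModRegular

variable {R : Type t} [Ring R] {C : Type u} [Category.{v} C] [Abelian C] [Linear R C] [HasExt.{w} C]

/-- **Postcomposition with a homothety-multiple is zero on annihilated classes.** If `S.f = x • φ` and
`x` kills every class of `Extⁿ(N, S.X₂)`, then `e ≫ S.f = 0` for every `e ∈ Extⁿ(N, S.X₁)`.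
Model: `S.f = x · 1_L`, `x ∈ sann_R(N)` (then `x · Ext¹_R(N, L) = 0`). [this work; KERNEL-g18 LEMMA 2.1] -/
theorem comp_mk₀_eq_zero_of_smul_eq_zero {S : ShortComplex C} (N : C) {n : ℕ} {x : R}
    (φ : S.X₁ ⟶ S.X₂) (hf : S.f = x • φ) (hx : ∀ e : Ext N S.X₂ n, x • e = 0)
    (e : Ext N S.X₁ n) : e.comp (Ext.mk₀ S.f) (add_zero n) = 0 := by
  rw [hf, Ext.mk₀_smul, Ext.comp_smul]
  exact hx _

/-- **Injectivity of reduction.** For a short exact `S : X₁ → X₂ → X₃` with `S.f = x • φ` and `x` killing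
`Extⁿ(N, S.X₂)`, postcomposition with `S.g` is injective on `Extⁿ(N, S.X₂)`: a class with values in `X₂`
is zero as soon as its image with values in the «reduced» object `X₃` is zero. Model: `0 → L →x L → L/xL → 0`
with `L` `x`-torsion-free and `x ∈ sann_R(N)`: `Ext¹_R(N, L) ↪ Ext¹_R(N, L/xL)`.
[this work; KERNEL-g18 LEMMA 2.1 (⊇), via Mathlib `covariant_sequence_exact₂`] -/
theorem comp_mk₀_injective_of_smul_eq_zero {S : ShortComplex C} (hS : S.ShortExact) (N : C) {n : ℕ}
    {x : R} (φ : S.X₁ ⟶ S.X₂) (hf : S.f = x • φ) (hx : ∀ e : Ext N S.X₂ n, x • e = 0) :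
    Function.Injective fun e : Ext N S.X₂ n => e.comp (Ext.mk₀ S.g) (add_zero n) := by
  -- an additive map with trivial kernel is injective
  have hker : ∀ e : Ext N S.X₂ n, e.comp (Ext.mk₀ S.g) (add_zero n) = 0 → e = 0 := by
    intro e he
    obtain ⟨e₁, rfl⟩ := Ext.covariant_sequence_exact₂ N hS e he
    exact comp_mk₀_eq_zero_of_smul_eq_zero N φ hf hx e₁
  intro e₁ e₂ h
  have h' : (e₁ - e₂).comp (Ext.mk₀ S.g) (add_zero n) = 0 := by
    simp only at h
    rw [sub_eq_add_neg, Ext.add_comp, Ext.neg_comp, h, add_neg_cancel]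
  exact sub_eq_zero.mp (hker _ h')

/-- **Annihilation is decided after reduction.** Under the hypotheses of
`comp_mk₀_injective_of_smul_eq_zero`, for every scalar `a : R` and every class `e ∈ Extⁿ(N, S.X₂)`:
`a • e = 0 ↔ a • (e ≫ S.g) = 0`. Model (`n = 1`, `S.X₂ = ΩN`, `e = ξ_N` the class of the minimal cover,
`x ∈ sann_R(N)` regular on `ΩN`): `a ∈ sann_R(N) ⟺ a · (ξ_N mod x) = 0` — the Ext-half of
«`sann_R(N) = π⁻¹ sann_{R/xR}(N/xN)`», which places the `⅟5` bit in the artinian algebra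
`Λ = R/(y₁¹⁰, y₂¹⁰, y₃¹⁰)R`. [this work; KERNEL-g18 LEMMA 2.1 / COROLLARY 2.3] -/
theorem smul_eq_zero_iff_smul_comp_mk₀_eq_zero {S : ShortComplex C} (hS : S.ShortExact) (N : C)
    {n : ℕ} {x : R} (φ : S.X₁ ⟶ S.X₂) (hf : S.f = x • φ) (hx : ∀ e : Ext N S.X₂ n, x • e = 0)
    (a : R) (e : Ext N S.X₂ n) :
    a • e = 0 ↔ a • e.comp (Ext.mk₀ S.g) (add_zero n) = 0 := by
  constructor
  · intro h
    rw [← Ext.smul_comp, h, Ext.zero_comp]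
  · intro h
    apply comp_mk₀_injective_of_smul_eq_zero hS N φ hf hx
    simp only
    rw [Ext.smul_comp, h, Ext.zero_comp]

end Summit.ResolutionOfSingularities.ResolutionOfSingularities.Theorems.NoZeno.ReductionModRegular

end
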